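import Literature.AlgebraicGeometry.AbelianSchemes.AbelianSchemeLDeltaLocusOfPolarization
import Literature.AlgebraicGeometry.AbelianSchemes.AbelianSchemeLDeltaLocusClosed
import Literature.AlgebraicGeometry.AbelianSchemes.PoincareSheafBiadditiveNoetherian
import Literature.AlgebraicGeometry.AbelianSchemes.PoincareSheafBiadditiveAnyBase
import Literature.AlgebraicGeometry.AbelianSchemes.RigidifiedLineBundleTensor
import Literature.AlgebraicGeometry.AbelianVarieties.LineBundleTensorPower
import HarnessLib

/-!
# Prop. 6.11 in MFK's CUBE SPELLING `L_T ≅ L^Δ_T(ω)^{⊗k}`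
# ([MumfordFogartyKirwan1994] Ch. 6 §2 Prop. 6.11 «such that `L_T = L^Δ(kλ)`»; Ch. 7 §2 Prop. 7.3 step (V)
# «`L′₄ ⊗ 𝒪_S ≅ L^Δ(ω̄_S)^3`») — ANY locally Noetherian base (ed. 2)

Layer `Literature/AlgebraicGeometry/AbelianSchemes`, namespaces `…AbelianSchemeOver.DualPair` (§2) and `…AbelianSchemeOver`
(§3–§4).  THEOREMS ONLY (no definition, no named fact, no instance, no notation, no `sorry`).  Cell `hodgecm-mathlib` (D-0151),
F-DAG row F-2 (e) «MFK Prop. 6.11», brick B3e of B-p17 (g12): adapters between the spelling of ★ `exists_isClosedImmersion_iff_exists_LDelta`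
/ ★ `exists_LDelta_of_polarization` — «`L_T ≅ Γ_k^*𝒫`» with `Γ_k = (pr, ω^k ≫ pr_Â) : A_T → A ×_S Â`, i.e. `L_T ≅ L^Δ_T(ω^k)` — and the
spelling a consumer of Prop. 7.3 step (V) holds — «`L_T ≅ L^Δ_T(ω)^{⊗k}`» (`k = 3` in print).
HC_CM is proved only modulo the 7 printed citations until rung 0 closes; nothing here is about HC.

EDITION 2 (B-p17 (g13), in-place upgrade per B-plan1 (g16) 2026-08-30T07:57:00Z/07:57:42Z; byte α-4 of B-p17 (g12)'s census
`B-provers/B-p17/g12/CENSUS-F6V-LDeltaCubeLocus.B-p17g12.md` §3): every `[PreconnectedSpace S]` of ed. 1 is DROPPED (§2 is now the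
any-base biadditivity ★ `nonempty_pullback_whiskerLeft_pow_iso_tensorPow` of ★ `PoincareSheafBiadditiveAnyBase` read in the `pullbackP`
spelling; §4 rides on eds. 2 of ★ `AbelianSchemeLDeltaLocusClosed` / ★ `AbelianSchemeLDeltaLocusOfPolarization`), and
`exists_LDelta_of_polarization_tensorPow` also drops `[PreconnectedSpace T] [Nonempty T]`; names and explicit binders unchanged.
Needed because the moduli base `H₄` of Prop. 7.3 step (V) and its test schemes are not connected.

* (§1, not restated: the unit hypothesis `hD` base-changes to ★ `D.baseChange g` — ★
  `DualPair.nonempty_unitHatSlice_baseChange_iso` of `AbelianSchemeDualTransportOfBaseChange`; every ★ statement taking `hD` is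
  thereby available over a sub-base `T`.)
* §2 **`DualPair.nonempty_pullbackP_pow_iso_tensorPow_of_isLocallyNoetherian`** — `(1_A × gⁿ)^*𝒫 ≅ ((1_A × g)^*𝒫)^{⊗n}` for a
  `T`-valued point `g` of `Â`, over ANY LOCALLY NOETHERIAN base (no reducedness, no connectedness; ed. 2 = ★
  `nonempty_pullback_whiskerLeft_pow_iso_tensorPow` in the `pullbackP` spelling — the reduced-base edition is ★
  `nonempty_pullbackP_pow_iso_tensorPow`).
* §3 **`nonempty_pullback_graph_pow_iso_tensorPow`** — `Γ_k^*𝒫 ≅ (Γ_1^*𝒫)^{⊗k}` on `A_T`, i.e. `L^Δ_T(ω^k) ≅ L^Δ_T(ω)^{⊗k}`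
  (§2 along the `S`-point `ω ≫ pr_Â` of `Â` with values in `A_T`, ★ `IsBaseChangeVia.pushHom`, restricted along the section
  `(pr, 1) : A_T → A ×_S A_T`; ★ `nonempty_pullback_tensorPow_iso`).
* §4 **`exists_isClosedImmersion_iff_exists_LDelta_tensorPow`** — ★ Prop. 6.11 (homomorphism form) with the right-hand side
  spelled «`∃ m Γ₁, m` hom, `[2k] ≫ m = Λ(L)_T`, `Γ₁ = (pr, m ≫ pr_Â)`, `L_T ≅ (Γ₁^*𝒫)^{⊗k}`»;
  **`exists_LDelta_of_polarization_tensorPow`** — ★ `exists_LDelta_of_polarization` from «`L_T ≅ L^Δ_T(pol.lam)^{⊗k}`».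

## References
* [MumfordFogartyKirwan1994] D. Mumford, J. Fogarty, F. Kirwan, *Geometric Invariant Theory*, 3rd ed. (1994), Ch. 6 §2
  Prop. 6.10 (p. 121), Prop. 6.11 (p. 122; proof pp. 122–123); Ch. 6 §1 Cor. 6.8 (p. 118); Ch. 7 §2 Prop. 7.3 (pp. 132–134), step (V).
* [MumfordAV1970] D. Mumford, *Abelian Varieties* (1970), §8 (pp. 74–75), §13 (p. 123).
* [MilneAV2008] J. S. Milne, *Abelian Varieties* (v2.00, 2008), I §8 pp. 36–37.
* [Hartshorne1977] R. Hartshorne, *Algebraic Geometry* (1977), II Ex. 6.8 (a), III Ex. 4.5.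
-/

-- `Scheme.Modules` / `SheafOfModules` are not reducible (as in Mathlib's `AlgebraicGeometry/Modules/Sheaf.lean`).
set_option backward.isDefEq.respectTransparency false

noncomputable section

open CategoryTheory CategoryTheory.Limits AlgebraicGeometry MonoidalCategory CartesianMonoidalCategory
open scoped MonObj

universe u

namespace Literature.AlgebraicGeometry.AbelianSchemes

open Literature.AlgebraicGeometry.Motives Literature.AlgebraicGeometry.Modules
  Literature.AlgebraicGeometry.AbelianVarieties

namespace AbelianSchemeOver

/-- `M ≅ M′ ⟹ M^{⊗n} ≅ M′^{⊗n}` (plumbing, the ★ `DualIsogenyMulN` device). [cite: MilneAV2008, I §8 pp. 36–37] -/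
private theorem nonempty_tensorPow_iso_of_iso' {X : Scheme.{u}} {M M' : X.Modules} (e : M ≅ M') :
    ∀ n : ℕ, Nonempty (tensorPow M n ≅ tensorPow M' n)
  | 0 => ⟨Iso.refl _⟩
  | n + 1 => (nonempty_tensorPow_iso_of_iso' e n).map fun i => tensorMapIso i e

namespace DualPair

variable {S S' : Scheme.{u}} {A : AbelianSchemeOver S} (D : A.DualPair) (g : S' ⟶ S)

/-! ## §2 `(1_A × gⁿ)^*𝒫 ≅ ((1_A × g)^*𝒫)^{⊗n}` over any locally Noetherian base -/

/-- **`(1_A × gⁿ)^*𝒫 ≅ ((1_A × g)^*𝒫)^{⊗ n}`** on `A_T`, for `S` locally Noetherian (ed. 2: connectedness dropped), the unit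
hypothesis `hD`, an `S`-scheme `T` and a `T`-valued point `g : T → Â`, `gⁿ` its `n`-th power in the group `Hom_S(T, Â)` — the
★ `nonempty_pullbackP_pow_iso_tensorPow` statement WITHOUT reducedness of the base: the any-base biadditivity of `𝒫`
([MumfordAV1970] §8 theorem of the square / §13) iterated, ★ `nonempty_pullback_whiskerLeft_pow_iso_tensorPow` read through ★
`pullbackP_eq_pullback_whiskerLeft`. [cite: MumfordAV1970, §8 (pp. 74–75) and §13 (p. 123)] [cite: MilneAV2008, I §8 pp. 36–37] -/
theorem nonempty_pullbackP_pow_iso_tensorPow_of_isLocallyNoetherian [IsLocallyNoetherian S]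
    (hD : Nonempty ((Scheme.Modules.pullback (unitHatSlice D)).obj D.P ≅ SheafOfModules.unit _))
    {T : Over S} (g : T ⟶ D.hat.X) :
    ∀ n : ℕ, Nonempty (D.pullbackP T.hom (g ^ n).left (Over.w _) ≅ tensorPow (D.pullbackP T.hom g.left (Over.w g)) n) :=
  fun n => by
    rw [D.pullbackP_eq_pullback_whiskerLeft (g ^ n), D.pullbackP_eq_pullback_whiskerLeft g]
    exact D.nonempty_pullback_whiskerLeft_pow_iso_tensorPow hD g n

end DualPair

/-! ## §3 `L^Δ_T(ω^k) ≅ L^Δ_T(ω)^{⊗k}` in the `Γ`-spelling -/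

variable {S : Scheme.{u}} (A : AbelianSchemeOver S) (D : A.DualPair)

/-- **`Γ_k^*𝒫 ≅ (Γ_1^*𝒫)^{⊗k}` on `A_T`** («`L^Δ_T(ω^k) ≅ L^Δ_T(ω)^{⊗k}`»), for `S` locally Noetherian (ed. 2: any) with the unit
hypothesis `hD`, `b : T → S`, an `Over T`-morphism `ω : A_T → Â_T` and `Γ_j = (pr, ω^j ≫ pr_Â) : A_T → A ×_S Â` (`j = 1, k`,
given by their projections).  Proof: `Γ_j = (pr, 1) ≫ (1_A × g^j)` for the `S`-point `g = ω ≫ pr_Â : A_T → Â` (★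
`IsBaseChangeVia.pushHom`, multiplicative) and the section `(pr, 1) : A_T → A ×_S A_T`; §2 for `g`, restricted along `(pr, 1)`
(★ `nonempty_pullback_tensorPow_iso`). [cite: MumfordFogartyKirwan1994, Ch. 6 §2 Prop. 6.10 (p. 121) and Prop. 6.11 (p. 122; proof pp. 122–123)]
[cite: MumfordAV1970, §8 (pp. 74–75) and §13 (p. 123)] -/
theorem nonempty_pullback_graph_pow_iso_tensorPow [IsLocallyNoetherian S]
    (hD : Nonempty ((Scheme.Modules.pullback (DualPair.unitHatSlice D)).obj D.P ≅ SheafOfModules.unit _))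
    {T : Scheme.{u}} (b : T ⟶ S) (ω : (A.baseChange b).X ⟶ (D.hat.baseChange b).X) (k : ℕ)
    (Γ₁ Γk : (A.baseChange b).left ⟶ A.prodLeft D.hat)
    (hΓ₁₁ : Γ₁ ≫ pullback.fst A.X.hom D.hat.X.hom = pullback.fst A.X.hom b)
    (hΓ₁₂ : Γ₁ ≫ pullback.snd A.X.hom D.hat.X.hom = ω.left ≫ pullback.fst D.hat.X.hom b)
    (hΓk₁ : Γk ≫ pullback.fst A.X.hom D.hat.X.hom = pullback.fst A.X.hom b)
    (hΓk₂ : Γk ≫ pullback.snd A.X.hom D.hat.X.hom = (ω ^ k).left ≫ pullback.fst D.hat.X.hom b) :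
    Nonempty ((Scheme.Modules.pullback Γk).obj D.P ≅ tensorPow ((Scheme.Modules.pullback Γ₁).obj D.P) k) := by
  have h := D.hat.baseChange_isBaseChangeVia b
  -- `A_T` as an `S`-scheme and the `S`-point `g = ω ≫ pr_Â` of `Â`
  let T₀ : Over S := Over.mk ((A.baseChange b).X.hom ≫ b)
  let g : T₀ ⟶ D.hat.X := h.pushHom ω
  have hgn : ∀ n : ℕ, (g ^ n).left = (ω ^ n).left ≫ pullback.fst D.hat.X.hom b := fun n => by
    have hn : g ^ n = h.pushHom (ω ^ n) := (map_pow (MonoidHom.mk' h.pushHom h.pushHom_mul) ω n).symm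
    rw [hn, IsBaseChangeVia.pushHom_left]
  -- the section `σ = (pr, 1) : A_T → A ×_S A_T` and `σ ≫ (1_A × gⁿ) = Γ_n`
  let σ : (A.baseChange b).left ⟶ pullback A.X.hom T₀.hom :=
    pullback.lift (pullback.fst A.X.hom b) (𝟙 _) (by rw [Category.id_comp]; exact pullback.condition)
  have hσ : ∀ (n : ℕ) (Γ : (A.baseChange b).left ⟶ A.prodLeft D.hat),
      Γ ≫ pullback.fst A.X.hom D.hat.X.hom = pullback.fst A.X.hom b →
      Γ ≫ pullback.snd A.X.hom D.hat.X.hom = (ω ^ n).left ≫ pullback.fst D.hat.X.hom b →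
        σ ≫ A.baseChangeToProd D.hat T₀.hom (g ^ n).left (Over.w _) = Γ := by
    intro n Γ h₁ h₂
    apply pullback.hom_ext
    · rw [Category.assoc, baseChangeToProd_fst, pullback.lift_fst, h₁]
    · rw [Category.assoc, baseChangeToProd_snd, pullback.lift_snd_assoc, Category.id_comp, hgn, h₂]
  have eΓ : ∀ (n : ℕ) (Γ : (A.baseChange b).left ⟶ A.prodLeft D.hat),
      Γ ≫ pullback.fst A.X.hom D.hat.X.hom = pullback.fst A.X.hom b →
      Γ ≫ pullback.snd A.X.hom D.hat.X.hom = (ω ^ n).left ≫ pullback.fst D.hat.X.hom b →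
        Nonempty ((Scheme.Modules.pullback Γ).obj D.P ≅
          (Scheme.Modules.pullback σ).obj (D.pullbackP T₀.hom (g ^ n).left (Over.w _))) := fun n Γ h₁ h₂ =>
    ⟨(Scheme.Modules.pullbackCongr (hσ n Γ h₁ h₂).symm).app D.P ≪≫ ((Scheme.Modules.pullbackComp σ _).app D.P).symm⟩
  -- §2 along `g`, restricted along `σ`
  obtain ⟨p⟩ := D.nonempty_pullbackP_pow_iso_tensorPow_of_isLocallyNoetherian hD g k
  obtain ⟨t⟩ := Modules.nonempty_pullback_tensorPow_iso σ (hasRank_pullback _ D.hasRank_one :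
    HasRank (D.pullbackP T₀.hom g.left (Over.w g)) 1) k
  obtain ⟨ek⟩ := eΓ k Γk hΓk₁ hΓk₂
  obtain ⟨e₁⟩ := eΓ 1 Γ₁ hΓ₁₁ (by rw [pow_one]; exact hΓ₁₂)
  have e₁' : (Scheme.Modules.pullback σ).obj (D.pullbackP T₀.hom g.left (Over.w g)) ≅
      (Scheme.Modules.pullback Γ₁).obj D.P :=
    (Scheme.Modules.pullback σ).mapIso (eqToIso (D.pullbackP_congr T₀.hom (congrArg Over.Hom.left (pow_one g).symm) _ _)) ≪≫ e₁.symm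
  obtain ⟨tk⟩ := nonempty_tensorPow_iso_of_iso' e₁' k
  exact ⟨ek ≪≫ (Scheme.Modules.pullback σ).mapIso p ≪≫ t ≪≫ tk⟩

/-! ## §4 Prop. 6.11 with «`L_T ≅ L^Δ_T(m)^{⊗k}`» -/

variable {L : A.left.Modules} (hL : HasRank L 1)
  (hε : CechPic.pullback A.unitSection (detClass (HasRank.isFiniteLocallyFree' hL)) = 1)
  (lam : A.X ⟶ D.hat.X) [IsMonHom lam]
  (hlam : ∀ ⦃T : Over S⦄ (u : T ⟶ A.X),
    Nonempty (D.pullbackP T.hom (u ≫ lam).left (Over.w _) ≅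
      (Scheme.Modules.pullback (A.X ◁ u).left).obj (A.mumfordBundle L)))

/-- The compatibility making `(pr, m^j ≫ pr_Â)` a point of `A ×_S Â`: `pr ≫ π = (m^j ≫ pr_Â) ≫ π̂`.
[cite: MumfordFogartyKirwan1994, Ch. 6 §2 Prop. 6.11 (p. 122; proof pp. 122–123)] -/
theorem fst_comp_hom_eq_pow_left_comp_fst_comp_hom {T : Scheme.{u}} (b : T ⟶ S)
    (m : (A.baseChange b).X ⟶ (D.hat.baseChange b).X) (j : ℕ) :
    pullback.fst A.X.hom b ≫ A.X.hom = ((m ^ j).left ≫ pullback.fst D.hat.X.hom b) ≫ D.hat.X.hom := by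
  rw [pullback.condition, Category.assoc, pullback.condition, ← Category.assoc]
  exact congrArg (· ≫ b) (Over.w (m ^ j)).symm

include hL hε hlam in
/-- **[MumfordFogartyKirwan1994] Prop. 6.11 (homomorphism form) with MFK's spelling `L_T ≅ L^Δ_T(m)^{⊗k}`**: for `S` locally
Noetherian (ed. 2: any; ed. 1 assumed `S` connected), `(Â, 𝒫)` with the unit hypothesis, `L` rigidified with `lam` classifying its Mumford family, and `2k`
invertible on `S`, there is a closed `j : Z ↪ S` such that for EVERY `b : T → S`: `b` factors through `j` iff there are a
homomorphism `m : A_T → Â_T` with `[2k] ≫ m = Λ(L)_T` and `Γ₁ = (pr, m ≫ pr_Â)` with `pr^*L ≅ (Γ₁^*𝒫)^{⊗k}` («`L_T = L^Δ(m)^{⊗k}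
= L^Δ(k·m)`») — ★ `exists_isClosedImmersion_iff_exists_LDelta` with its `Γ_k^*𝒫` rewritten by §3.
[cite: MumfordFogartyKirwan1994, Ch. 6 §2 Prop. 6.11 (p. 122; proof pp. 122–123)] [cite: MumfordFogartyKirwan1994, Ch. 7 §2 Proposition 7.3 (pp. 132–134)] -/
theorem exists_isClosedImmersion_iff_exists_LDelta_tensorPow [IsLocallyNoetherian S]
    (hD : Nonempty ((Scheme.Modules.pullback (DualPair.unitHatSlice D)).obj D.P ≅ SheafOfModules.unit _))
    {k : ℕ} (hk : ∀ s : S, ((2 * k : ℕ) : S.residueField s) ≠ 0) :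
    ∃ (Z : Scheme.{u}) (j : Z ⟶ S), IsClosedImmersion j ∧
      ∀ ⦃T : Scheme.{u}⦄ (b : T ⟶ S),
        (∃ v : T ⟶ Z, v ≫ j = b) ↔
          ∃ (m : (A.baseChange b).X ⟶ (D.hat.baseChange b).X) (Γ₁ : (A.baseChange b).left ⟶ A.prodLeft D.hat),
            IsMonHom m ∧ ((𝟙 (A.baseChange b).X) ^ (2 * k)) ≫ m = (Over.pullback b).map lam ∧
              Γ₁ ≫ pullback.fst A.X.hom D.hat.X.hom = pullback.fst A.X.hom b ∧
              Γ₁ ≫ pullback.snd A.X.hom D.hat.X.hom = m.left ≫ pullback.fst D.hat.X.hom b ∧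
              Nonempty ((Scheme.Modules.pullback (pullback.fst A.X.hom b)).obj L ≅
                tensorPow ((Scheme.Modules.pullback Γ₁).obj D.P) k) := by
  obtain ⟨Z, j, hj, H⟩ := A.exists_isClosedImmersion_iff_exists_LDelta D hL hD hε lam hlam hk
  refine ⟨Z, j, hj, fun T b => (H b).trans ⟨?_, ?_⟩⟩
  · rintro ⟨m, Γk, hm, hdesc, hΓk₁, hΓk₂, ⟨e⟩⟩
    let Γ₁ : (A.baseChange b).left ⟶ A.prodLeft D.hat :=
      pullback.lift (pullback.fst A.X.hom b) ((m ^ 1).left ≫ pullback.fst D.hat.X.hom b)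
        (A.fst_comp_hom_eq_pow_left_comp_fst_comp_hom D b m 1)
    have hΓ₁₁ : Γ₁ ≫ pullback.fst A.X.hom D.hat.X.hom = pullback.fst A.X.hom b := pullback.lift_fst _ _ _
    have hΓ₁₂ : Γ₁ ≫ pullback.snd A.X.hom D.hat.X.hom = m.left ≫ pullback.fst D.hat.X.hom b := by
      rw [pullback.lift_snd, pow_one]
    obtain ⟨c⟩ := A.nonempty_pullback_graph_pow_iso_tensorPow D hD b m k Γ₁ Γk hΓ₁₁ hΓ₁₂ hΓk₁ hΓk₂
    exact ⟨m, Γ₁, hm, hdesc, hΓ₁₁, hΓ₁₂, ⟨e ≪≫ c⟩⟩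
  · rintro ⟨m, Γ₁, hm, hdesc, hΓ₁₁, hΓ₁₂, ⟨e⟩⟩
    let Γk : (A.baseChange b).left ⟶ A.prodLeft D.hat :=
      pullback.lift (pullback.fst A.X.hom b) ((m ^ k).left ≫ pullback.fst D.hat.X.hom b)
        (A.fst_comp_hom_eq_pow_left_comp_fst_comp_hom D b m k)
    have hΓk₁ : Γk ≫ pullback.fst A.X.hom D.hat.X.hom = pullback.fst A.X.hom b := pullback.lift_fst _ _ _
    have hΓk₂ : Γk ≫ pullback.snd A.X.hom D.hat.X.hom = (m ^ k).left ≫ pullback.fst D.hat.X.hom b :=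
      pullback.lift_snd _ _ _
    obtain ⟨c⟩ := A.nonempty_pullback_graph_pow_iso_tensorPow D hD b m k Γ₁ Γk hΓ₁₁ hΓ₁₂ hΓk₁ hΓk₂
    exact ⟨m, Γk, hm, hdesc, hΓk₁, hΓk₂, ⟨e ≪≫ c.symm⟩⟩

include hL hε hlam in
/-- **Polarized objects lie in the locus, cube spelling** ([MumfordFogartyKirwan1994] Prop. 7.3 step (V) verbatim: «if the induced
abelian scheme … comes from a polarized … abelian scheme, then that polarization `ω̄_S` must satisfy `L′₄ ⊗ 𝒪_S ≅ L^Δ(ω̄_S)^3`»):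
for `S` locally Noetherian with `hD`, `T` locally Noetherian (ed. 2: neither connected nor nonempty — ed. 1 assumed `S`, `T`
connected and `T` nonempty), `b : T → S`, a polarisation `pol` of `(A_T, Â_T, 𝒫_T)`, `Γ₁ = (pr, pol.lam ≫ pr_Â)` and
`pr^*L ≅ (Γ₁^*𝒫)^{⊗k}`, the right-hand side of ★ `exists_isClosedImmersion_iff_exists_LDelta` holds at `b` (★
`exists_LDelta_of_polarization`, ed. 2 over any locally Noetherian `T`, + §3).
[cite: MumfordFogartyKirwan1994, Ch. 6 §2 Prop. 6.11 (p. 122; proof pp. 122–123)] [cite: MumfordFogartyKirwan1994, Ch. 7 §2 Proposition 7.3 (pp. 132–134)] -/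
theorem exists_LDelta_of_polarization_tensorPow [IsLocallyNoetherian S]
    (hD : Nonempty ((Scheme.Modules.pullback (DualPair.unitHatSlice D)).obj D.P ≅ SheafOfModules.unit _))
    {T : Scheme.{u}} [IsLocallyNoetherian T] (b : T ⟶ S)
    (pol : (A.baseChange b).Polarization (D.baseChange b)) (k : ℕ) (Γ₁ : (A.baseChange b).left ⟶ A.prodLeft D.hat)
    (hΓ₁₁ : Γ₁ ≫ pullback.fst A.X.hom D.hat.X.hom = pullback.fst A.X.hom b)
    (hΓ₁₂ : Γ₁ ≫ pullback.snd A.X.hom D.hat.X.hom = pol.lam.left ≫ pullback.fst D.hat.X.hom b)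
    (e : Nonempty ((Scheme.Modules.pullback (pullback.fst A.X.hom b)).obj L ≅
      tensorPow ((Scheme.Modules.pullback Γ₁).obj D.P) k)) :
    ∃ (m : (A.baseChange b).X ⟶ (D.hat.baseChange b).X) (Γ : (A.baseChange b).left ⟶ A.prodLeft D.hat),
      IsMonHom m ∧ ((𝟙 (A.baseChange b).X) ^ (2 * k)) ≫ m = (Over.pullback b).map lam ∧
        Γ ≫ pullback.fst A.X.hom D.hat.X.hom = pullback.fst A.X.hom b ∧
        Γ ≫ pullback.snd A.X.hom D.hat.X.hom = (m ^ k).left ≫ pullback.fst D.hat.X.hom b ∧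
        Nonempty ((Scheme.Modules.pullback (pullback.fst A.X.hom b)).obj L ≅ (Scheme.Modules.pullback Γ).obj D.P) := by
  let Γk : (A.baseChange b).left ⟶ A.prodLeft D.hat :=
    pullback.lift (pullback.fst A.X.hom b) ((pol.lam ^ k).left ≫ pullback.fst D.hat.X.hom b)
      (A.fst_comp_hom_eq_pow_left_comp_fst_comp_hom D b pol.lam k)
  have hΓk₁ : Γk ≫ pullback.fst A.X.hom D.hat.X.hom = pullback.fst A.X.hom b := pullback.lift_fst _ _ _
  have hΓk₂ : Γk ≫ pullback.snd A.X.hom D.hat.X.hom = (pol.lam ^ k).left ≫ pullback.fst D.hat.X.hom b :=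
    pullback.lift_snd _ _ _
  obtain ⟨c⟩ := A.nonempty_pullback_graph_pow_iso_tensorPow D hD b pol.lam k Γ₁ Γk hΓ₁₁ hΓ₁₂ hΓk₁ hΓk₂
  obtain ⟨e⟩ := e
  exact A.exists_LDelta_of_polarization D hL hε lam hlam b pol k Γk hΓk₁ hΓk₂ ⟨e ≪≫ c.symm⟩

end AbelianSchemeOver

end Literature.AlgebraicGeometry.AbelianSchemes

end
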